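import Summits.AtomisticToContinuum.FouriersLaw.Theses.VanishingNoiseTransfer
import Summits.AtomisticToContinuum.FouriersLaw.Theses.JunctionLocality
import Summits.AtomisticToContinuum.FouriersLaw.Theorems.PhononMeanFreePathBoundaryKubo

/-!
# The `N`-uniform conductance floor of the deterministic chain: its exact logical position
(helpers for stub `stub_uniformConductanceFloor`)

Helper file `--supports stmt-AtomisticToContinuum-11975` (crux `NoiseLocality`, route
`VanishingNoiseTransfer`, line `relative-flip-energy-transfer`, stub 5 `stub_uniformConductanceFloor`).

The stub (called `UCF` below; it is always written out, no definition is introduced) asks, for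
`pinnedChain ω₂ lam β γ` (all parameters `> 0`) and `T > 0`, for ONE constant `d > 0` such that for
EVERY length `N ≥ 2`, the unique deterministic weak steady family `μ0` of the `N`-chain and any
response coefficient `D0 = lim_{δ → 0, δ ≠ 0} totalCurrent(μ0 (T+δ/2) (T-δ/2))/δ` satisfy `d ≤ D0` —
an `N`-UNIFORM conductance floor. This file pins down exactly what that is, sorry-free:

* `iff_conductanceLowerBound_and_positiveConductance` — **`UCF ↔ ConductanceLowerBound ∧
  PositiveConductance`** (the sibling route `JunctionLocality`'s items stmt-AtomisticToContinuum-11749,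
  `liminf_N D_N > 0`, and stmt-AtomisticToContinuum-11750, `D_N > 0` for `N ≥ 2`), UNCONDITIONALLY:
  the two shared supports that the reduction needs are discharged — weak-NESS uniqueness `NessUnique`
  (stmt-0741, in the tree: `NessUnique_holds`) and the existence of the finite-`N` response
  coefficients along every steady family (the content of stmt-0717 `FiniteResponseOfUnique`), read
  off the landed boundary Kubo identity `boundaryKubo_proof` (stmt-11812) in `exists_responseCoeff`.
  (→): instantiate the floor at the given family (`N₁ = 2`). (←): choose a global reference steady
  family (`pinnedChain_exists_isSteadyState`) with its response sequence `D`, get `c ≤ D N` for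
  `N ≥ N₁` from 11749 and `D N > 0` on the finite stretch `2 ≤ N < N₁` from 11750
  (`floor_of_eventually_floor`, a finite minimum), and transfer the floor to every per-`N` unique
  family, whose response quotients are the reference ones for `|δ| < T` (`floor_transfer`).
* `of_positiveConductance_of_responseLimit` — the second supplier: if along every steady family the
  response sequence CONVERGES TO A POSITIVE LIMIT (clause (ii) of
  `OscillatorChain.FouriersLawFor (pinnedChain …)` in the frame of the sibling items, stated inline),
  then eventually `D_N ≥ κ/2` (this is 11749), hence with 11750 the stub.
* `responseLimit_of_fouriersLaw`, `of_positiveConductance_of_fouriersLaw` — in particular the floor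
  is NECESSARY modulo finite-`N` positivity: `PositiveConductance → FouriersLaw → UCF` (the conjunct
  supplies the convergence; response sequences are unique by uniqueness of limits).

So after this file the stub is exactly the edge `11749 ∧ 11750` (0741 proved, 0717's content proved
here); 11749 — an `N`-uniform lower bound on the NESS current of a deterministic anharmonic chain —
is the load-bearing open item. Registered helper sub-goals (one line each, at the end):
`helper_existsResponseCoeff`, `helper_uniformConductanceFloorIffSiblings`,
`helper_uniformConductanceFloorOfResponseLimit`, `helper_uniformConductanceFloorOfFouriersLaw`.
No definitions.
-/

noncomputable section

open MeasureTheory Filter Topology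

namespace Summit.AtomisticToContinuum.FouriersLaw.Theorems.NoiseLocality.StubUniformConductanceFloor

open Literature.MathematicalPhysics.KineticTheory.HeatConduction

/-! ### Pure real analysis: floors of real sequences -/

/-- A real sequence which is positive from index `2` on and bounded below by `c > 0` from index `N₁`
on is bounded below by ONE positive constant from index `2` on (minimum over the finite stretch
`2 ≤ N < N₁`). [folklore] -/
theorem floor_of_eventually_floor {D : ℕ → ℝ} (hpos : ∀ N : ℕ, 2 ≤ N → 0 < D N) {c : ℝ}
    (hc : 0 < c) {N₁ : ℕ} (hN₁ : ∀ N : ℕ, N₁ ≤ N → c ≤ D N) :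
    ∃ d : ℝ, 0 < d ∧ ∀ N : ℕ, 2 ≤ N → d ≤ D N := by
  have hfin : ∃ d₀ : ℝ, 0 < d₀ ∧ ∀ N ∈ Finset.Ico 2 N₁, d₀ ≤ D N := by
    by_cases hne : (Finset.Ico 2 N₁).Nonempty
    · refine ⟨(Finset.Ico 2 N₁).inf' hne D, ?_, fun N hN => Finset.inf'_le _ hN⟩
      obtain ⟨N, hN, hEq⟩ := Finset.exists_mem_eq_inf' hne D
      rw [hEq]
      exact hpos N (Finset.mem_Ico.mp hN).1
    · exact ⟨1, one_pos, fun N hN => (hne ⟨N, hN⟩).elim⟩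
  obtain ⟨d₀, hd₀, hd₀le⟩ := hfin
  refine ⟨min c d₀, lt_min hc hd₀, fun N hN => ?_⟩
  rcases lt_or_ge N N₁ with hlt | hge
  · exact (min_le_right _ _).trans (hd₀le N (Finset.mem_Ico.mpr ⟨hN, hlt⟩))
  · exact (min_le_left _ _).trans (hN₁ N hge)

/-- A real sequence converging to a positive limit `κ` is bounded below by `κ/2 > 0` from some index
on. [folklore] -/
theorem eventually_floor_of_tendsto {D : ℕ → ℝ} {κ : ℝ} (hκ : 0 < κ)
    (hD : Tendsto D atTop (𝓝 κ)) :
    ∃ c : ℝ, 0 < c ∧ ∃ N₁ : ℕ, ∀ N : ℕ, N₁ ≤ N → c ≤ D N := by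
  obtain ⟨N₁, hN₁⟩ := eventually_atTop.mp (hD.eventually_const_le (half_lt_self hκ))
  exact ⟨κ / 2, half_pos hκ, N₁, hN₁⟩

/-! ### Steady families of a chain: response quotients of the unique family, transfer of a floor -/

/-- For `T > 0`, a per-`N` family `μ0` of weak steady states that is UNIQUE at all positive
temperatures and any family `μ1` of weak steady states of the same chain have the same response
quotients `totalCurrent(μ (T+δ/2) (T-δ/2))/δ` for `|δ| < T` (the two families coincide there), so
`D` is a response coefficient of the one iff of the other. [folklore] -/
theorem tendsto_responseQuotient_iff (P : OscillatorChain) {N : ℕ} {T : ℝ} (hT : 0 < T)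
    (μ0 μ1 : ℝ → ℝ → Measure (PhaseSpace N))
    (hμ0 : ∀ T_L T_R : ℝ, 0 < T_L → 0 < T_R → P.IsSteadyState N T_L T_R (μ0 T_L T_R) ∧
      ∀ ν : Measure (PhaseSpace N), P.IsSteadyState N T_L T_R ν → ν = μ0 T_L T_R)
    (hμ1 : ∀ T_L T_R : ℝ, 0 < T_L → 0 < T_R → P.IsSteadyState N T_L T_R (μ1 T_L T_R)) (D : ℝ) :
    Tendsto (fun δ : ℝ => P.totalCurrent (μ0 (T + δ / 2) (T - δ / 2)) / δ) (𝓝[≠] 0) (𝓝 D) ↔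
      Tendsto (fun δ : ℝ => P.totalCurrent (μ1 (T + δ / 2) (T - δ / 2)) / δ) (𝓝[≠] 0) (𝓝 D) := by
  have hev : (fun δ : ℝ => P.totalCurrent (μ0 (T + δ / 2) (T - δ / 2)) / δ) =ᶠ[𝓝[≠] (0 : ℝ)]
      fun δ : ℝ => P.totalCurrent (μ1 (T + δ / 2) (T - δ / 2)) / δ := by
    have hball : ∀ᶠ δ : ℝ in 𝓝 (0 : ℝ), |δ| < T := by
      have : Metric.ball (0 : ℝ) T ∈ 𝓝 (0 : ℝ) := Metric.ball_mem_nhds 0 hT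
      filter_upwards [this] with δ hδ
      simpa [Real.dist_eq] using hδ
    filter_upwards [nhdsWithin_le_nhds hball] with δ hδ
    have h1 : 0 < T + δ / 2 := by linarith [(abs_lt.mp hδ).1]
    have h2 : 0 < T - δ / 2 := by linarith [(abs_lt.mp hδ).2]
    rw [(hμ0 _ _ h1 h2).2 _ (hμ1 _ _ h1 h2)]
  exact ⟨fun h => h.congr' hev, fun h => h.congr' hev.symm⟩

/-- **Transfer of a floor.** If along ONE family `μ` of weak steady states (all lengths) with
response coefficients `D N` at `T > 0` one has `d ≤ D N` for all `N ≥ 2`, then `d ≤ D0` for every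
`N ≥ 2`, every per-`N` UNIQUE steady family `μ0` and every response coefficient `D0` of it at `T`
(`tendsto_responseQuotient_iff` + uniqueness of limits along `𝓝[≠] 0`). [folklore] -/
theorem floor_transfer (P : OscillatorChain) {T : ℝ} (hT : 0 < T)
    (μ : (N : ℕ) → ℝ → ℝ → Measure (PhaseSpace N))
    (hμ : ∀ (N : ℕ) (T_L T_R : ℝ), 0 < T_L → 0 < T_R → P.IsSteadyState N T_L T_R (μ N T_L T_R))
    (D : ℕ → ℝ)
    (hD : ∀ N : ℕ, Tendsto (fun δ : ℝ => P.totalCurrent (μ N (T + δ / 2) (T - δ / 2)) / δ)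
      (𝓝[≠] 0) (𝓝 (D N)))
    {d : ℝ} (hd : ∀ N : ℕ, 2 ≤ N → d ≤ D N) :
    ∀ N : ℕ, 2 ≤ N → ∀ μ0 : ℝ → ℝ → Measure (PhaseSpace N),
      (∀ T_L T_R : ℝ, 0 < T_L → 0 < T_R → P.IsSteadyState N T_L T_R (μ0 T_L T_R) ∧
        ∀ ν : Measure (PhaseSpace N), P.IsSteadyState N T_L T_R ν → ν = μ0 T_L T_R) →
      ∀ D0 : ℝ, Tendsto (fun δ : ℝ => P.totalCurrent (μ0 (T + δ / 2) (T - δ / 2)) / δ)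
        (𝓝[≠] 0) (𝓝 D0) → d ≤ D0 := by
  intro N hN μ0 hμ0 D0 hD0
  have hD0' := (tendsto_responseQuotient_iff P hT μ0 (μ N) hμ0 (hμ N) D0).mp hD0
  rw [tendsto_nhds_unique hD0' (hD N)]
  exact hd N hN

/-! ### The pinned chain: the discharged supports (0741 by name, 0717's content from 11812) -/

section PinnedChain

variable {ω₂ lam β γ : ℝ}

/-- A global family of weak steady states of `pinnedChain ω₂ lam β γ` (all parameters `> 0`) at all
lengths and positive temperatures exists (choice on the landed existence theorem
`pinnedChain_exists_isSteadyState`, Cuneo–Eckmann–Hairer–Rey-Bellet 2018 Thm 2.13; junk `0` off the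
positive quadrant). [cite: CuneoEckmannHairerReyBellet2018, Thm 2.13] -/
theorem exists_steadyFamily (hω : 0 < ω₂) (hl : 0 < lam) (hβ : 0 < β) (hγ : 0 < γ) :
    ∃ μ : (N : ℕ) → ℝ → ℝ → Measure (PhaseSpace N), ∀ (N : ℕ) (T_L T_R : ℝ), 0 < T_L → 0 < T_R →
      (pinnedChain ω₂ lam β γ).IsSteadyState N T_L T_R (μ N T_L T_R) := by
  classical
  refine ⟨fun N T_L T_R => if h : 0 < T_L ∧ 0 < T_R then
      Classical.choose (pinnedChain_exists_isSteadyState hω hl hβ hγ N h.1 h.2) else 0, ?_⟩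
  intro N T_L T_R hL hR
  simp only [dif_pos (And.intro hL hR)]
  exact Classical.choose_spec (pinnedChain_exists_isSteadyState hω hl hβ hγ N hL hR)

/-- **The finite-`N` response coefficient exists along every steady family** (the content of the
shared support stmt-AtomisticToContinuum-0717 `FiniteResponseOfUnique`, its uniqueness premise being
the theorem `NessUnique_holds`): for `N = 0` the empty chain carries no current (`D = 0`); for
`N = M + 1` the landed boundary Kubo identity `boundaryKubo_proof` (stmt-11812) gives the limit
`M (γ²/T²) ∫₀^∞ Cov_{μ_T}(p_0², K_t p_M²) dt`. [cite: CuneoEckmannHairerReyBellet2018, Thm 2.13] -/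
theorem exists_responseCoeff (hω : 0 < ω₂) (hl : 0 < lam) (hβ : 0 < β) (hγ : 0 < γ)
    (μ : (N : ℕ) → ℝ → ℝ → Measure (PhaseSpace N))
    (hμ : ∀ (N : ℕ) (T_L T_R : ℝ), 0 < T_L → 0 < T_R →
      (pinnedChain ω₂ lam β γ).IsSteadyState N T_L T_R (μ N T_L T_R))
    {T : ℝ} (hT : 0 < T) (N : ℕ) :
    ∃ D : ℝ, Tendsto (fun δ : ℝ =>
      (pinnedChain ω₂ lam β γ).totalCurrent (μ N (T + δ / 2) (T - δ / 2)) / δ) (𝓝[≠] 0) (𝓝 D) := by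
  cases N with
  | zero =>
    refine ⟨0, ?_⟩
    simp only [OscillatorChain.totalCurrent_zero, zero_div]
    exact tendsto_const_nhds
  | succ M =>
    exact ⟨_, (Theorems.PhononMeanFreePathBoundaryKubo.boundaryKubo_proof ω₂ lam β γ hω hl hβ hγ
      (Theses.VanishingNoiseTransfer.NessUnique_holds ω₂ lam β γ hω hl hβ hγ) μ hμ T hT M).2⟩

/-- **A reference steady family with its response sequence**: for all parameters `> 0` and `T > 0`
there are a global family `μ` of weak steady states and `D : ℕ → ℝ` with
`totalCurrent(μ N (T+δ/2) (T-δ/2))/δ → D N` (`δ → 0`, `δ ≠ 0`) for every `N`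
(`exists_steadyFamily`, `exists_responseCoeff`, choice). [cite: CuneoEckmannHairerReyBellet2018, Thm 2.13] -/
theorem exists_steadyFamily_responseCoeff (hω : 0 < ω₂) (hl : 0 < lam) (hβ : 0 < β) (hγ : 0 < γ)
    {T : ℝ} (hT : 0 < T) :
    ∃ μ : (N : ℕ) → ℝ → ℝ → Measure (PhaseSpace N),
      (∀ (N : ℕ) (T_L T_R : ℝ), 0 < T_L → 0 < T_R →
        (pinnedChain ω₂ lam β γ).IsSteadyState N T_L T_R (μ N T_L T_R)) ∧
      ∃ D : ℕ → ℝ, ∀ N : ℕ, Tendsto (fun δ : ℝ =>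
        (pinnedChain ω₂ lam β γ).totalCurrent (μ N (T + δ / 2) (T - δ / 2)) / δ) (𝓝[≠] 0) (𝓝 (D N)) := by
  obtain ⟨μ, hμ⟩ := exists_steadyFamily hω hl hβ hγ
  choose D hD using exists_responseCoeff hω hl hβ hγ μ hμ hT
  exact ⟨μ, hμ, D, hD⟩

end PinnedChain

/-! ### The stub ↔ the sibling items 11749 ∧ 11750 -/

/-- **`UCF ↔ ConductanceLowerBound ∧ PositiveConductance`** (stub `stub_uniformConductanceFloor`,
on the left, versus route `JunctionLocality`'s items stmt-AtomisticToContinuum-11749 and -11750),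
unconditionally. (→) at a steady family `μ` with response sequence `D` (under the items' uniqueness
premise `μ N` is the unique family at level `N`): `d ≤ D N` for `N ≥ 2` gives `N₁ = 2` and
`0 < d ≤ D N`. (←) reference family and response sequence from `exists_steadyFamily_responseCoeff`
(the items' uniqueness premise is `NessUnique_holds`), a floor along it by
`floor_of_eventually_floor`, transferred to every per-`N` unique family by `floor_transfer`.
[folklore] -/
theorem iff_conductanceLowerBound_and_positiveConductance :
    (∀ ω₂ lam β γ : ℝ, 0 < ω₂ → 0 < lam → 0 < β → 0 < γ → ∀ T : ℝ, 0 < T → ∃ d : ℝ, 0 < d ∧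
      ∀ N : ℕ, 2 ≤ N → ∀ μ0 : ℝ → ℝ → Measure (PhaseSpace N),
      (∀ T_L T_R : ℝ, 0 < T_L → 0 < T_R →
        (pinnedChain ω₂ lam β γ).IsSteadyState N T_L T_R (μ0 T_L T_R) ∧
          ∀ ν : Measure (PhaseSpace N),
            (pinnedChain ω₂ lam β γ).IsSteadyState N T_L T_R ν → ν = μ0 T_L T_R) →
      ∀ D0 : ℝ, Tendsto (fun δ : ℝ =>
        (pinnedChain ω₂ lam β γ).totalCurrent (μ0 (T + δ / 2) (T - δ / 2)) / δ) (𝓝[≠] 0) (𝓝 D0) →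
      d ≤ D0) ↔
    Theses.JunctionLocality.ConductanceLowerBound ∧ Theses.JunctionLocality.PositiveConductance := by
  constructor
  · intro h
    refine ⟨?_, ?_⟩
    · intro ω₂ lam β γ hω hl hβ hγ huniq μ hμ T hT D hD
      obtain ⟨d, hd, hfloor⟩ := h ω₂ lam β γ hω hl hβ hγ T hT
      exact ⟨d, hd, 2, fun N hN => hfloor N hN (μ N)
        (fun T_L T_R hL hR => ⟨hμ N T_L T_R hL hR, fun ν hν =>
          huniq N T_L T_R hL hR ν (μ N T_L T_R) hν (hμ N T_L T_R hL hR)⟩) (D N) (hD N)⟩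
    · intro ω₂ lam β γ hω hl hβ hγ huniq μ hμ T hT D hD N hN
      obtain ⟨d, hd, hfloor⟩ := h ω₂ lam β γ hω hl hβ hγ T hT
      exact hd.trans_le (hfloor N hN (μ N)
        (fun T_L T_R hL hR => ⟨hμ N T_L T_R hL hR, fun ν hν =>
          huniq N T_L T_R hL hR ν (μ N T_L T_R) hν (hμ N T_L T_R hL hR)⟩) (D N) (hD N))
  · rintro ⟨hCLB, hPC⟩ ω₂ lam β γ hω hl hβ hγ T hT
    have huniq := Theses.VanishingNoiseTransfer.NessUnique_holds ω₂ lam β γ hω hl hβ hγ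
    obtain ⟨μ, hμ, D, hD⟩ := exists_steadyFamily_responseCoeff hω hl hβ hγ hT
    obtain ⟨c, hc, N₁, hN₁⟩ := hCLB ω₂ lam β γ hω hl hβ hγ huniq μ hμ T hT D hD
    have hpos : ∀ N : ℕ, 2 ≤ N → 0 < D N := hPC ω₂ lam β γ hω hl hβ hγ huniq μ hμ T hT D hD
    obtain ⟨d, hd, hdle⟩ := floor_of_eventually_floor hpos hc hN₁
    exact ⟨d, hd, floor_transfer (pinnedChain ω₂ lam β γ) hT μ hμ D hD hdle⟩

/-- **The stub from the sibling items** stmt-11749 (`ConductanceLowerBound`) and stmt-11750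
(`PositiveConductance`) taken by name (direction `←` of
`iff_conductanceLowerBound_and_positiveConductance`); 11749 is the load-bearing open item. [folklore] -/
theorem of_conductanceLowerBound_of_positiveConductance
    (hCLB : Theses.JunctionLocality.ConductanceLowerBound)
    (hPC : Theses.JunctionLocality.PositiveConductance) :
    ∀ ω₂ lam β γ : ℝ, 0 < ω₂ → 0 < lam → 0 < β → 0 < γ → ∀ T : ℝ, 0 < T → ∃ d : ℝ, 0 < d ∧
      ∀ N : ℕ, 2 ≤ N → ∀ μ0 : ℝ → ℝ → Measure (PhaseSpace N),
      (∀ T_L T_R : ℝ, 0 < T_L → 0 < T_R →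
        (pinnedChain ω₂ lam β γ).IsSteadyState N T_L T_R (μ0 T_L T_R) ∧
          ∀ ν : Measure (PhaseSpace N),
            (pinnedChain ω₂ lam β γ).IsSteadyState N T_L T_R ν → ν = μ0 T_L T_R) →
      ∀ D0 : ℝ, Tendsto (fun δ : ℝ =>
        (pinnedChain ω₂ lam β γ).totalCurrent (μ0 (T + δ / 2) (T - δ / 2)) / δ) (𝓝[≠] 0) (𝓝 D0) →
      d ≤ D0 :=
  iff_conductanceLowerBound_and_positiveConductance.mpr ⟨hCLB, hPC⟩

/-! ### The second supplier: convergence of the responses to a positive limit -/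

/-- **The stub from `PositiveConductance` (stmt-11750) and convergence of the responses to a
positive limit.** If, in the frame of the sibling items (uniqueness premise, every steady family,
every `T > 0`, every response sequence `D`), the response sequence converges to SOME positive limit
— clause (ii) of `OscillatorChain.FouriersLawFor (pinnedChain …)` per family — then eventually
`D_N ≥ κ/2` (`eventually_floor_of_tendsto`; this is exactly item 11749 `ConductanceLowerBound`), and
`of_conductanceLowerBound_of_positiveConductance` applies. [folklore] -/
theorem of_positiveConductance_of_responseLimit
    (hPC : Theses.JunctionLocality.PositiveConductance)
    (hRL : ∀ ω₂ lam β γ : ℝ, 0 < ω₂ → 0 < lam → 0 < β → 0 < γ →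
      (∀ (N : ℕ) (T_L T_R : ℝ), 0 < T_L → 0 < T_R → ∀ μ ν : Measure (PhaseSpace N),
        (pinnedChain ω₂ lam β γ).IsSteadyState N T_L T_R μ →
          (pinnedChain ω₂ lam β γ).IsSteadyState N T_L T_R ν → μ = ν) →
      ∀ μ : (N : ℕ) → ℝ → ℝ → Measure (PhaseSpace N),
      (∀ (N : ℕ) (T_L T_R : ℝ), 0 < T_L → 0 < T_R →
        (pinnedChain ω₂ lam β γ).IsSteadyState N T_L T_R (μ N T_L T_R)) →
      ∀ T : ℝ, 0 < T → ∀ D : ℕ → ℝ,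
      (∀ N : ℕ, Tendsto (fun δ : ℝ =>
        (pinnedChain ω₂ lam β γ).totalCurrent (μ N (T + δ / 2) (T - δ / 2)) / δ) (𝓝[≠] 0)
          (𝓝 (D N))) →
      ∃ κ : ℝ, 0 < κ ∧ Tendsto D atTop (𝓝 κ)) :
    ∀ ω₂ lam β γ : ℝ, 0 < ω₂ → 0 < lam → 0 < β → 0 < γ → ∀ T : ℝ, 0 < T → ∃ d : ℝ, 0 < d ∧
      ∀ N : ℕ, 2 ≤ N → ∀ μ0 : ℝ → ℝ → Measure (PhaseSpace N),
      (∀ T_L T_R : ℝ, 0 < T_L → 0 < T_R →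
        (pinnedChain ω₂ lam β γ).IsSteadyState N T_L T_R (μ0 T_L T_R) ∧
          ∀ ν : Measure (PhaseSpace N),
            (pinnedChain ω₂ lam β γ).IsSteadyState N T_L T_R ν → ν = μ0 T_L T_R) →
      ∀ D0 : ℝ, Tendsto (fun δ : ℝ =>
        (pinnedChain ω₂ lam β γ).totalCurrent (μ0 (T + δ / 2) (T - δ / 2)) / δ) (𝓝[≠] 0) (𝓝 D0) →
      d ≤ D0 := by
  have hCLB : Theses.JunctionLocality.ConductanceLowerBound := by
    intro ω₂ lam β γ hω hl hβ hγ huniq μ hμ T hT D hD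
    obtain ⟨κ, hκ, hlim⟩ := hRL ω₂ lam β γ hω hl hβ hγ huniq μ hμ T hT D hD
    exact eventually_floor_of_tendsto hκ hlim
  exact of_conductanceLowerBound_of_positiveConductance hCLB hPC

/-- **The conjunct supplies the convergence hypothesis.** `FouriersLaw` (clause (ii) of
`FouriersLawFor (pinnedChain …)`: one conductivity `κ(T) > 0` to which the response sequence of EVERY
steady family converges) implies the per-family convergence statement assumed in
`of_positiveConductance_of_responseLimit`: a given response sequence `D` of a steady family agrees
termwise with the one provided by the conjunct (uniqueness of limits along `𝓝[≠] 0`), so `D → κ(T)`.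
[cite: BonettoLebowitzReyBellet2000, §5.3 eq. (33)] -/
theorem responseLimit_of_fouriersLaw (hFL : _root_.FouriersLaw) :
    ∀ ω₂ lam β γ : ℝ, 0 < ω₂ → 0 < lam → 0 < β → 0 < γ →
      (∀ (N : ℕ) (T_L T_R : ℝ), 0 < T_L → 0 < T_R → ∀ μ ν : Measure (PhaseSpace N),
        (pinnedChain ω₂ lam β γ).IsSteadyState N T_L T_R μ →
          (pinnedChain ω₂ lam β γ).IsSteadyState N T_L T_R ν → μ = ν) →
      ∀ μ : (N : ℕ) → ℝ → ℝ → Measure (PhaseSpace N),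
      (∀ (N : ℕ) (T_L T_R : ℝ), 0 < T_L → 0 < T_R →
        (pinnedChain ω₂ lam β γ).IsSteadyState N T_L T_R (μ N T_L T_R)) →
      ∀ T : ℝ, 0 < T → ∀ D : ℕ → ℝ,
      (∀ N : ℕ, Tendsto (fun δ : ℝ =>
        (pinnedChain ω₂ lam β γ).totalCurrent (μ N (T + δ / 2) (T - δ / 2)) / δ) (𝓝[≠] 0)
          (𝓝 (D N))) →
      ∃ κ : ℝ, 0 < κ ∧ Tendsto D atTop (𝓝 κ) := by
  intro ω₂ lam β γ hω hl hβ hγ _huniq μ hμ T hT D hD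
  obtain ⟨-, κ, hκ, hii⟩ := hFL ω₂ lam β γ hω hl hβ hγ
  obtain ⟨D', hD', hlim⟩ := hii μ hμ T hT
  have hDD : D = D' := funext fun N => tendsto_nhds_unique (hD N) (hD' N)
  exact ⟨κ T, hκ T hT, hDD ▸ hlim⟩

/-- **Necessity modulo finite-`N` positivity: `PositiveConductance → FouriersLaw → UCF`.** The
`N`-uniform conductance floor asked by the stub is implied by the conjunct itself together with
stmt-11750 (`responseLimit_of_fouriersLaw` + `of_positiveConductance_of_responseLimit`).
[cite: BonettoLebowitzReyBellet2000, §5.3 eq. (33)] -/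
theorem of_positiveConductance_of_fouriersLaw
    (hPC : Theses.JunctionLocality.PositiveConductance) (hFL : _root_.FouriersLaw) :
    ∀ ω₂ lam β γ : ℝ, 0 < ω₂ → 0 < lam → 0 < β → 0 < γ → ∀ T : ℝ, 0 < T → ∃ d : ℝ, 0 < d ∧
      ∀ N : ℕ, 2 ≤ N → ∀ μ0 : ℝ → ℝ → Measure (PhaseSpace N),
      (∀ T_L T_R : ℝ, 0 < T_L → 0 < T_R →
        (pinnedChain ω₂ lam β γ).IsSteadyState N T_L T_R (μ0 T_L T_R) ∧
          ∀ ν : Measure (PhaseSpace N),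
            (pinnedChain ω₂ lam β γ).IsSteadyState N T_L T_R ν → ν = μ0 T_L T_R) →
      ∀ D0 : ℝ, Tendsto (fun δ : ℝ =>
        (pinnedChain ω₂ lam β γ).totalCurrent (μ0 (T + δ / 2) (T - δ / 2)) / δ) (𝓝[≠] 0) (𝓝 D0) →
      d ≤ D0 :=
  of_positiveConductance_of_responseLimit hPC (responseLimit_of_fouriersLaw hFL)

/-! ### Registered helper sub-goals (stub form, one line each) -/

/-- Registered helper sub-goal `helper_existsResponseCoeff` of stub `stub_uniformConductanceFloor`
(= `exists_responseCoeff` in stub form): along every family of weak steady states of the pinned chain the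
finite-`N` response coefficient exists, for every `T > 0` and `N` (the content of item stmt-0717, no
uniqueness premise). [folklore] -/
theorem helper_existsResponseCoeff : ∀ ω₂ lam β γ : ℝ, 0 < ω₂ → 0 < lam → 0 < β → 0 < γ → ∀ μ : (N : ℕ) → ℝ → ℝ → MeasureTheory.Measure (Literature.MathematicalPhysics.KineticTheory.HeatConduction.PhaseSpace N), (∀ (N : ℕ) (T_L T_R : ℝ), 0 < T_L → 0 < T_R → (Literature.MathematicalPhysics.KineticTheory.HeatConduction.pinnedChain ω₂ lam β γ).IsSteadyState N T_L T_R (μ N T_L T_R)) → ∀ T : ℝ, 0 < T → ∀ N : ℕ, ∃ D : ℝ, Filter.Tendsto (fun δ : ℝ => (Literature.MathematicalPhysics.KineticTheory.HeatConduction.pinnedChain ω₂ lam β γ).totalCurrent (μ N (T + δ / 2) (T - δ / 2)) / δ) (nhdsWithin 0 {(0 : ℝ)}ᶜ) (nhds D) :=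
  fun _ _ _ _ hω hl hβ hγ μ hμ _ hT N => exists_responseCoeff hω hl hβ hγ μ hμ hT N

/-- Registered helper sub-goal `helper_uniformConductanceFloorIffSiblings` of stub `stub_uniformConductanceFloor`
(= `iff_conductanceLowerBound_and_positiveConductance` in stub form): the stub, verbatim, is equivalent to
the conjunction of items stmt-11749 and stmt-11750. [folklore] -/
theorem helper_uniformConductanceFloorIffSiblings : (∀ ω₂ lam β γ : ℝ, 0 < ω₂ → 0 < lam → 0 < β → 0 < γ → ∀ T : ℝ, 0 < T → ∃ d : ℝ, 0 < d ∧ ∀ N : ℕ, 2 ≤ N → ∀ μ0 : ℝ → ℝ → MeasureTheory.Measure (Literature.MathematicalPhysics.KineticTheory.HeatConduction.PhaseSpace N), (∀ T_L T_R : ℝ, 0 < T_L → 0 < T_R → (Literature.MathematicalPhysics.KineticTheory.HeatConduction.pinnedChain ω₂ lam β γ).IsSteadyState N T_L T_R (μ0 T_L T_R) ∧ ∀ ν : MeasureTheory.Measure (Literature.MathematicalPhysics.KineticTheory.HeatConduction.PhaseSpace N), (Literature.MathematicalPhysics.KineticTheory.HeatConduction.pinnedChain ω₂ lam β γ).IsSteadyState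 N T_L T_R ν → ν = μ0 T_L T_R) → ∀ D0 : ℝ, Filter.Tendsto (fun δ : ℝ => (Literature.MathematicalPhysics.KineticTheory.HeatConduction.pinnedChain ω₂ lam β γ).totalCurrent (μ0 (T + δ / 2) (T - δ / 2)) / δ) (nhdsWithin 0 {(0 : ℝ)}ᶜ) (nhds D0) → d ≤ D0) ↔ Summit.AtomisticToContinuum.FouriersLaw.Theses.JunctionLocality.ConductanceLowerBound ∧ Summit.AtomisticToContinuum.FouriersLaw.Theses.JunctionLocality.PositiveConductance :=
  iff_conductanceLowerBound_and_positiveConductance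

/-- Registered helper sub-goal `helper_uniformConductanceFloorOfResponseLimit` of stub
`stub_uniformConductanceFloor` (= `of_positiveConductance_of_responseLimit` in stub form): the stub, verbatim,
from item stmt-11750 and per-family convergence of the responses to a positive limit. [folklore] -/
theorem helper_uniformConductanceFloorOfResponseLimit : Summit.AtomisticToContinuum.FouriersLaw.Theses.JunctionLocality.PositiveConductance → (∀ ω₂ lam β γ : ℝ, 0 < ω₂ → 0 < lam → 0 < β → 0 < γ → (∀ (N : ℕ) (T_L T_R : ℝ), 0 < T_L → 0 < T_R → ∀ μ ν : MeasureTheory.Measure (Literature.MathematicalPhysics.KineticTheory.HeatConduction.PhaseSpace N), (Literature.MathematicalPhysics.KineticTheory.HeatConduction.pinnedChain ω₂ lam β γ).IsSteadyState N T_L T_R μ → (Literature.MathematicalPhysics.KineticTheory.HeatConduction.pinnedChain ω₂ lam β γ).IsSteadyState N T_L T_R ν → μ = ν) → ∀ μ : (N : ℕ) → ℝ → ℝ → MeasureTheory.Measure (Literature.MathematicalPhysics.KineticTheory.HeatConduction.PhaseSpace N), (∀ (N : ℕ) (T_L T_R : ℝ), 0 < T_L → 0 < T_R → (Literature.MathematicalPhysics.KineticTheory.HeatConduction.pinnedChain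 ω₂ lam β γ).IsSteadyState N T_L T_R (μ N T_L T_R)) → ∀ T : ℝ, 0 < T → ∀ D : ℕ → ℝ, (∀ N : ℕ, Filter.Tendsto (fun δ : ℝ => (Literature.MathematicalPhysics.KineticTheory.HeatConduction.pinnedChain ω₂ lam β γ).totalCurrent (μ N (T + δ / 2) (T - δ / 2)) / δ) (nhdsWithin 0 {(0 : ℝ)}ᶜ) (nhds (D N))) → ∃ κ : ℝ, 0 < κ ∧ Filter.Tendsto D Filter.atTop (nhds κ)) → ∀ ω₂ lam β γ : ℝ, 0 < ω₂ → 0 < lam → 0 < β → 0 < γ → ∀ T : ℝ, 0 < T → ∃ d : ℝ, 0 < d ∧ ∀ N : ℕ, 2 ≤ N → ∀ μ0 : ℝ → ℝ → MeasureTheory.Measure (Literature.MathematicalPhysics.KineticTheory.HeatConduction.PhaseSpace N), (∀ T_L T_R : ℝ, 0 < T_L → 0 < T_R → (Literature.MathematicalPhysics.KineticTheory.HeatConduction.pinnedChain ω₂ lam β γ).IsSteadyState N T_L T_R (μ0 T_L T_R) ∧ ∀ ν : MeasureTheory.Measure (Literature.MathematicalPhysics.KineticTheory.HeatConduction.PhaseSpace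 N), (Literature.MathematicalPhysics.KineticTheory.HeatConduction.pinnedChain ω₂ lam β γ).IsSteadyState N T_L T_R ν → ν = μ0 T_L T_R) → ∀ D0 : ℝ, Filter.Tendsto (fun δ : ℝ => (Literature.MathematicalPhysics.KineticTheory.HeatConduction.pinnedChain ω₂ lam β γ).totalCurrent (μ0 (T + δ / 2) (T - δ / 2)) / δ) (nhdsWithin 0 {(0 : ℝ)}ᶜ) (nhds D0) → d ≤ D0 :=
  of_positiveConductance_of_responseLimit

/-- Registered helper sub-goal `helper_uniformConductanceFloorOfFouriersLaw` of stub `stub_uniformConductanceFloor`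
(= `of_positiveConductance_of_fouriersLaw` in stub form): the stub, verbatim, from item stmt-11750 and the
conjunct `FouriersLaw` (necessity modulo finite-`N` positivity). [folklore] -/
theorem helper_uniformConductanceFloorOfFouriersLaw : Summit.AtomisticToContinuum.FouriersLaw.Theses.JunctionLocality.PositiveConductance → Literature.MathematicalPhysics.KineticTheory.HeatConduction.FouriersLaw → ∀ ω₂ lam β γ : ℝ, 0 < ω₂ → 0 < lam → 0 < β → 0 < γ → ∀ T : ℝ, 0 < T → ∃ d : ℝ, 0 < d ∧ ∀ N : ℕ, 2 ≤ N → ∀ μ0 : ℝ → ℝ → MeasureTheory.Measure (Literature.MathematicalPhysics.KineticTheory.HeatConduction.PhaseSpace N), (∀ T_L T_R : ℝ, 0 < T_L → 0 < T_R → (Literature.MathematicalPhysics.KineticTheory.HeatConduction.pinnedChain ω₂ lam β γ).IsSteadyState N T_L T_R (μ0 T_L T_R) ∧ ∀ ν : MeasureTheory.Measure (Literature.MathematicalPhysics.KineticTheory.HeatConduction.PhaseSpace N), (Literature.MathematicalPhysics.KineticTheory.HeatConduction.pinnedChain ω₂ lam β γ).IsSteadyState N T_L T_R ν → ν = μ0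 T_L T_R) → ∀ D0 : ℝ, Filter.Tendsto (fun δ : ℝ => (Literature.MathematicalPhysics.KineticTheory.HeatConduction.pinnedChain ω₂ lam β γ).totalCurrent (μ0 (T + δ / 2) (T - δ / 2)) / δ) (nhdsWithin 0 {(0 : ℝ)}ᶜ) (nhds D0) → d ≤ D0 :=
  of_positiveConductance_of_fouriersLaw

end Summit.AtomisticToContinuum.FouriersLaw.Theorems.NoiseLocality.StubUniformConductanceFloor

end
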